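import Summits.AtomisticToContinuum.Crystallization.Theorems.ExcessDecayLiouvilleHcpLiouvilleOnePerSite
import Summits.AtomisticToContinuum.Crystallization.Theorems.ExcessDecayLiouvilleHcpLiouvilleTwoLatticeForce
import Summits.AtomisticToContinuum.Crystallization.Theorems.ExcessDecayLiouvilleHcpLiouvilleBlowdownDefs
import Summits.AtomisticToContinuum.Crystallization.Theorems.ExcessDecayLiouvilleHcpLiouvilleBlowdownCaccioppoli
import Summits.AtomisticToContinuum.Crystallization.Theorems.ExcessDecayLiouvilleHcpLiouvilleBlowdownIteration
import Summits.AtomisticToContinuum.Crystallization.Theorems.ExcessDecayLiouvilleHcpLiouvilleBlowdownImprovement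
import Summits.AtomisticToContinuum.Crystallization.Theorems.ExcessDecayLiouvilleHcpLiouvilleBlowdownRemainder
import Summits.AtomisticToContinuum.Crystallization.Theorems.ExcessDecayLiouvilleHcpLiouvilleBlowdownGreen
import Summits.AtomisticToContinuum.Crystallization.Theorems.ExcessDecayLiouvilleHcpLiouvilleBlowdownInterior

/-!
# `ExcessDecayLiouville.HcpLiouville` (stmt-AtomisticToContinuum-9332): the crux modulo the inputs of the line `Sketch`

The composition of skeleton v4 of the line `Sketch` (Cruxes/HcpLiouville/Lines/Sketch.lean) with EVERY ANALYTIC stub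
landed (`stub_onePerSite`, the anchor reduction, `stub_caccioppoli`, `stub_remainder`, `stub_green`, `stub_interior`,
`stub_improvement`, `stub_iteration`): `HcpLiouville` follows from (i) the relaxed inner shift of every admissible cell
and (ii) ray-secant coercivity `SecantCoercive (1/20) κ₁` for some `κ₁ > 0` — the two certified-computation inputs
`stub_coerciveInputs` of the line — `BlowdownLine.hcpLiouville_of_inputs`.  A `--supports` file for item
stmt-AtomisticToContinuum-9332 (it does not close the crux: the two inputs remain hypotheses).  All `[folklore]`.
-/

noncomputable section

namespace Summit.AtomisticToContinuum.Crystallization.Theorems.ExcessDecayLiouville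

namespace BlowdownLine

open scoped BigOperators Topology Classical InnerProductSpace
open Literature.MathematicalPhysics.StatisticalMechanics
open Summit.AtomisticToContinuum.Crystallization.Theses.ExcessDecayLiouville
open Summit.AtomisticToContinuum.Crystallization.Theorems.PhononStabilityNegative


/-! ## The crux in named form -/

/-- The crux is `PhononStability → (coarse Liouville over the mirror predicates)` by definitional
unfolding of its `let`s. [folklore] -/
theorem hcpLiouville_iff :
    HcpLiouville ↔
      (PhononStability → ∀ δ : ℝ, 0 < δ → ∀ X : Set (EuclideanSpace ℝ (Fin 3)), Sep₀ X δ → Equil₀ X →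
        ∀ (t : Fin 2 → (EuclideanSpace ℝ (Fin 3))) (A : (EuclideanSpace ℝ (Fin 3)) →L[ℝ] (EuclideanSpace ℝ (Fin 3))), Adm₀ A → Inner₀ t A →
          (∀ (c : (EuclideanSpace ℝ (Fin 3))) (r : ℝ), Near₀ X c r t A (1 / 40)) →
            ∃ (t' : Fin 2 → (EuclideanSpace ℝ (Fin 3))) (A' : (EuclideanSpace ℝ (Fin 3)) →L[ℝ] (EuclideanSpace ℝ (Fin 3))), Adm₀ A' ∧ X = Sites₀ t' A') :=
  Iff.rfl

/-! ## Composition -/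

section Composition

variable {X : Set (EuclideanSpace ℝ (Fin 3))} {t : Fin 2 → (EuclideanSpace ℝ (Fin 3))} {A : (EuclideanSpace ℝ (Fin 3)) →L[ℝ] (EuclideanSpace ℝ (Fin 3))} {u : (EuclideanSpace ℝ (Fin 3)) → (EuclideanSpace ℝ (Fin 3))} {τ : (EuclideanSpace ℝ (Fin 3))}

/-- The homogeneous anchor from the relaxed shift (landed reduction `anchor_of_relaxedShift`). [folklore] -/
theorem anchor_of_inputs
    (hRS : ∀ (A : (EuclideanSpace ℝ (Fin 3)) →L[ℝ] (EuclideanSpace ℝ (Fin 3))), Adm₀ A →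
      ∃ e : (EuclideanSpace ℝ (Fin 3)), ‖e - A (barlowOffset 1 + layerNormal (Real.sqrt (2 / 3)))‖ ≤ 1 / 40 ∧
        HasSum (fun z : Λ₀ => (deriv lennardJones ‖e + A z‖ / ‖e + A z‖) • (e + A z)) 0)
    (t : Fin 2 → (EuclideanSpace ℝ (Fin 3))) (A : (EuclideanSpace ℝ (Fin 3)) →L[ℝ] (EuclideanSpace ℝ (Fin 3))) (hA : Adm₀ A) (hI : Inner₀ t A) :
    ∃ τ : (EuclideanSpace ℝ (Fin 3)), ‖τ‖ ≤ 1 / 20 ∧ Inner₀ (anchorDatum t τ) A ∧ Equil₀ (Sites₀ (anchorDatum t τ) A) :=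
  anchor_of_relaxedShift hRS t A hA hI

/-- Packing count in the form consumed by `stub_iteration`: at most `32 r³` sites in a closed ball of radius
`r ≥ 1`. [folklore] -/
theorem card_ball_le (hA : Adm₀ A) (hI : Inner₀ t A) (c : (EuclideanSpace ℝ (Fin 3))) {r : ℝ} (hr : 1 ≤ r) (F : Finset (EuclideanSpace ℝ (Fin 3)))
    (hF : ∀ s ∈ F, s ∈ Sites₀ t A ∧ dist s c ≤ r) : (F.card : ℝ) ≤ 32 * r ^ 3 := by
  refine (LevelOne.card_sites_le' hA hI c (by linarith) F hF).trans ?_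
  have h1 : 2 * r / (23 / 25) + 1 ≤ (73 / 23) * r := by
    rw [div_add_one (by norm_num), div_le_iff₀ (by norm_num)]; nlinarith
  calc (2 * r / (23 / 25) + 1) ^ 3 ≤ ((73 / 23) * r) ^ 3 := pow_le_pow_left₀ (by positivity) h1 3
    _ = (73 / 23) ^ 3 * r ^ 3 := by ring
    _ ≤ 32 * r ^ 3 := by gcongr; norm_num

/-- Every point of space is within `2` of an anchored site. [folklore] -/
theorem exists_site_near (hA : Adm₀ A) (t' : Fin 2 → (EuclideanSpace ℝ (Fin 3))) (c : (EuclideanSpace ℝ (Fin 3))) : ∃ s ∈ Sites₀ t' A, dist s c ≤ 2 := by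
  obtain ⟨z, hz, hd⟩ := exists_site_dist_le hA t' 0 c
  exact ⟨t' 0 + A z, ⟨0, z, hz, rfl⟩, hd.trans (by norm_num)⟩

/-- **Endgame bookkeeping**: if the displacement seen from the anchored sites is the constant `m`, then `X` is the
anchored two-lattice translated by `m`. [folklore] -/
theorem sites_of_constant (hA : Adm₀ A) (hI : Inner₀ t A) (hIτ : Inner₀ (anchorDatum t τ) A)
    (hu : IsDisplacement X t A u) {m : (EuclideanSpace ℝ (Fin 3))}
    (hv : ∀ p ∈ Sites₀ (anchorDatum t τ) A, LevelOne.vField t A τ u p = m) :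
    X = Sites₀ (fun i => anchorDatum t τ i + m) A := by
  -- `u s = m + τ𝟙₁(s)` on the reference sites
  have hus : ∀ s ∈ Sites₀ t A, u s = m + shiftField t A τ s := by
    intro s hs
    have h1 := hv _ (LevelOne.fwd_mem hA hI hs)
    rw [LevelOne.vField_fwd hA hI hIτ u hs] at h1
    rw [← h1]; abel
  -- the anchored image of a reference site, sublattice by sublattice
  have hfwd : ∀ (i : Fin 2) (z : (EuclideanSpace ℝ (Fin 3))), z ∈ Λ₀ →
      (t i + A z) + shiftField t A τ (t i + A z) = anchorDatum t τ i + A z := by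
    intro i z hz
    have h := LevelOne.fwd_mem (τ := τ) hA hI (⟨i, z, hz, rfl⟩ : t i + A z ∈ Sites₀ t A)
    fin_cases i
    · simpa [LevelOne.fwd] using LevelOne.fwd_sub0 (τ := τ) hA hI hz
    · simpa [LevelOne.fwd] using LevelOne.fwd_sub1 t A τ hz
  ext x
  constructor
  · intro hx
    obtain ⟨s, hs, rfl⟩ := hu.2.surjOn hx
    obtain ⟨i, z, hz, rfl⟩ := hs
    refine ⟨i, z, hz, ?_⟩
    show (t i + A z) + u (t i + A z) = (anchorDatum t τ i + m) + A z
    rw [hus _ ⟨i, z, hz, rfl⟩, add_comm m, ← add_assoc, hfwd i z hz]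
    abel
  · rintro ⟨i, z, hz, rfl⟩
    have hs : t i + A z ∈ Sites₀ t A := ⟨i, z, hz, rfl⟩
    have hx : (t i + A z) + u (t i + A z) ∈ X := hu.2.mapsTo hs
    have heq : (t i + A z) + u (t i + A z) = (anchorDatum t τ i + m) + A z := by
      rw [hus _ hs, add_comm m, ← add_assoc, hfwd i z hz]
      abel
    rwa [heq] at hx

end Composition

/-- The coarse Liouville statement from the landed stubs, GIVEN the two certified-computation inputs (relaxed shift,
ray-secant coercivity). [folklore] -/
theorem core_of_inputs
    (hRS : ∀ (A : (EuclideanSpace ℝ (Fin 3)) →L[ℝ] (EuclideanSpace ℝ (Fin 3))), Adm₀ A →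
      ∃ e : (EuclideanSpace ℝ (Fin 3)), ‖e - A (barlowOffset 1 + layerNormal (Real.sqrt (2 / 3)))‖ ≤ 1 / 40 ∧
        HasSum (fun z : Λ₀ => (deriv lennardJones ‖e + A z‖ / ‖e + A z‖) • (e + A z)) 0)
    (hSC : ∃ κ₁ : ℝ, 0 < κ₁ ∧ SecantCoercive (1 / 20) κ₁) :
    PhononStability → ∀ δ : ℝ, 0 < δ → ∀ X : Set (EuclideanSpace ℝ (Fin 3)), Sep₀ X δ → Equil₀ X →
      ∀ (t : Fin 2 → (EuclideanSpace ℝ (Fin 3))) (A : (EuclideanSpace ℝ (Fin 3)) →L[ℝ] (EuclideanSpace ℝ (Fin 3))), Adm₀ A → Inner₀ t A →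
        (∀ (c : (EuclideanSpace ℝ (Fin 3))) (r : ℝ), Near₀ X c r t A (1 / 40)) →
          ∃ (t' : Fin 2 → (EuclideanSpace ℝ (Fin 3))) (A' : (EuclideanSpace ℝ (Fin 3)) →L[ℝ] (EuclideanSpace ℝ (Fin 3))), Adm₀ A' ∧ X = Sites₀ t' A' := by
  intro hPS δ hδ X hSep hEq t A hA hI hN
  obtain ⟨κ, hκ, hPSκ⟩ := phononStability_iff.1 hPS
  obtain ⟨u, hu⟩ := stub_onePerSite δ hδ X hSep hEq t A hA hI hN
  obtain ⟨κ₁, hκ₁, hSC⟩ := hSC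
  obtain ⟨τ, hτ, hIτ, hEτ⟩ := anchor_of_inputs hRS t A hA hI
  obtain ⟨C_C, hC⟩ := stub_caccioppoli (1 / 20) κ₁ hκ₁ hSC
  obtain ⟨C_R, hR⟩ := stub_remainder
  obtain ⟨C_F, hF⟩ := stub_green κ hκ
  obtain ⟨C_D, hD⟩ := stub_interior κ hκ
  obtain ⟨θ, R₀, K, hθ, hθ1, hR₀, hImp⟩ := stub_improvement (1 / 20) κ C_C C_R C_F C_D hκ hC hR hF hD
  have hPSτ : Blowdown.PSIneq κ (anchorDatum t τ) A := Blowdown.psIneq_of_forall hPSκ hA hIτ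
  have hIP := hImp X t A u τ hA hI hPSτ hEq hu hτ hIτ hEτ
  obtain ⟨m, hm⟩ := stub_iteration (Sites₀ (anchorDatum t τ) A) (LevelOne.vField t A τ u) θ R₀ K
    (fun c r => finite_sites_dist_le hA hIτ c r) (fun c r hr F hF => card_ball_le hA hIτ c hr F hF)
    (fun c => exists_site_near hA (anchorDatum t τ) c)
    (fun s hs => LevelOne.norm_vField_le hA hI hIτ hu hs) hθ hθ1 hR₀ hIP
  exact ⟨fun i => anchorDatum t τ i + m, A, hA, sites_of_constant hA hI hIτ hu hm⟩

/-- **The crux modulo its inputs**: `HcpLiouville` follows from the two certified-computation inputs of the line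
`Sketch` (the relaxed inner shift of every admissible cell, ray-secant coercivity at anchor radius `1/20`); every analytic
step is landed. [folklore] -/
theorem hcpLiouville_of_inputs :
    (∀ (A : EuclideanSpace ℝ (Fin 3) →L[ℝ] EuclideanSpace ℝ (Fin 3)), Adm₀ A →
      ∃ e : EuclideanSpace ℝ (Fin 3), ‖e - A (barlowOffset 1 + layerNormal (Real.sqrt (2 / 3)))‖ ≤ 1 / 40 ∧
        HasSum (fun z : Λ₀ => (deriv lennardJones ‖e + A z‖ / ‖e + A z‖) • (e + A z)) 0) →
    (∃ κ₁ : ℝ, 0 < κ₁ ∧ SecantCoercive (1 / 20) κ₁) → HcpLiouville :=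
  fun hRS hSC => hcpLiouville_iff.2 (core_of_inputs hRS hSC)

end BlowdownLine

end Summit.AtomisticToContinuum.Crystallization.Theorems.ExcessDecayLiouville

end
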